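import Summits.HodgeConjecture.HodgeConjecture.Theorems.HCCMUnconditionalH21OfLevelStructure
import Summits.HodgeConjecture.HodgeConjecture.Theorems.HCCMUnconditionalH21OfAbelianSchemeModel
import Literature.NumberTheory.ComplexMultiplication.CasselmanOfMainTheoremInertiaFlat
import HarnessLib

/-!
# The FLAT Casselman binder (Thm. 21.4 + Prop. 19.10, WITHOUT Thm. 19.11's «unramified ⟺ good reduction») from the main theorem of CM
# and the INERTIA form of good reduction — edition E-19.11♭1 of the `h21` leg (no converse of Néron–Ogg–Šafarevič)

Topic: summit `HodgeConjecture`, sub-problem `HodgeConjecture`, route `HCCMUnconditional`, crux `H21` (item stmt-HodgeConjecture-24834;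
`H21 := PrintedCitationHypotheses.Hyp21 := shimura1998_thm21_4_casselman` by `rfl`).  PROVER FILE (cell hodgecm-mathlib, D-0151 release
track, ladder HODGECM-MATHLIB rung 0; seat B-p14, second B-p21; `--supports stmt-HodgeConjecture-24834`): sorry-free, axioms ⊆ trio,
THEOREMS ONLY, namespace `Summit.HodgeConjecture.CorCM.Hyp21`.  Director g3 BATCH 112 (c) / B-plan1 `B6-SPEC` §3 (c), bodies after
B-plan1's slot file `B-plan/lines/e1911/CasselmanFlatOfMainTheoremInertia.slot.lean` (85197af0) and A-p01's `thm21_4_casselman_of_facts`.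

WHAT.  The `h21` binder `shimura1998_thm21_4_casselman` reads Thm. 21.4's «determines `χ`» as Prop. 19.10 + Thm. 19.11, i.e. it carries
clause (b) «`χ` is unramified at `v` iff `A₀` has good reduction at `v`», whose ⇒-half is Lemma 19.3 = the converse of Néron–Ogg–Šafarevič
(`h₃` on the floor of record, v6 ★ p621741).  B-plan1's census (B6-SPEC §1.3): NO consumer of the binder reads clause (b) — every one of the
86 threading files goes through `.exists_structure`, which discards it.  This file PROVES the ♭1 body of the binder — the conclusion of
`shimura1998_thm21_4_casselman.exists_structure` VERBATIM (realisation ∧ family with `χ_{τ₀} = χ` ∧ Frobenius clause), under the binder's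
five hypotheses — from row II-1 `shimura1998_thm18_6` and the inertia hypothesis `h₁₂` ALONE (no `h₃`), and from `{Thm. 18.6, r₀}` /
`{S7a levelStructure, S5b, r₀}` by name:

* `casselmanFlat_of_thm18_6_of_inertia (h186) (h₁₂)` — A-p01's `thm21_4_casselman_of_facts` body (cofinitely many good and unramified
  places; the two Frobenius descriptions agree there; `χ_{τ₀} = χ` by `HeckeCharacter.ext_of_eventually_valueAtUniformizer_eq`) over A-p10's
  `casselmanCore_of_thm18_6` and the Literature-side II-5♭ `shimuraTaniyama_heckeCharactersFlat_of_thm18_6_of_inertia` (B-p21), with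
  clause (4) of the family never formed;
* `casselmanFlat_of_thm18_6_of_r₀ (h186) (hr₀)` — `h₁₂` discharged modulo the bridge r₀ (body of
  `DiophantineGeometry.exists_isAbelianSchemeModel_of_hasGoodReductionAt` verbatim, as in `H21_of_thm18_6_of_r₀`) through
  `DiophantineGeometry.forall_inertia_tateRep_eq_one_of_hasGoodReductionAt` (Serre–Tate §1 Thm. 1, easy direction, PROVED);
* `casselmanFlat_of_levelStructure_of_r₀ (h7a) (h5b) (hr₀)` — the same at `h186 := thm18_6_of_levelStructure h7a h5b` (the floor's reading).

AFTER edition (a) lands (the binder's `def` loses clause (b), B-typ02) these producers ARE the binder: the §2 append then states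
`thm21_4_casselman_of_thm18_6_of_inertiaFlat : shimura1998_thm21_4_casselman` and the heads `H21_of_thm18_6_of_inertiaFlat`,
`H21_of_thm18_6_of_r₀Flat`, `H21_of_levelStructure_of_r₀Flat (h7a) (h5b) (hr₀) : HCCMUnconditional.H21` (floor v7's `h21` leg: 9 binders,
`h₃` gone).  Until then nothing here names the binder, so these bytes elaborate unchanged before and after (a).
HC_CM is proved only modulo the 7 printed citations until rung 0 closes; this file discharges no binder by itself — it removes one (`h₃`)
from the cone once (a) lands.

EDITION E-ST (director g3 BATCH 116; Phase B, landed in one bundle with B-typ02's re-keyed `def`): the binder's Frobenius clause is now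
keyed on SERRE–TATE good reduction «`A₀` has an abelian-scheme model over `𝓞_{k,v}`» ([SerreTate1968] §1, p. 492 — the printed
definition), so the inertia statement at such a place is the PROVED abelian-scheme mathematics of the r₀ chain and the bridge r₀ itself
(«a smooth proper model of the variety is an abelian scheme») is no longer needed: §2 states the r₀-FREE heads `thm21_4_casselman_of_thm18_6_ST`,
`H21_of_thm18_6_ST`, `H21_of_levelStructure_ST` over A-p08's producers (`HCCMUnconditionalH21OfAbelianSchemeModel`); §3's E-19.11♭1 heads keep
their names and types BYTE-IDENTICAL for their landed consumers and are re-proved through §1 + A-p08's weakening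
`casselmanST_of_casselmanFlat`; the former weakening
certificate `casselmanFlat_of_casselman` (scheme-level body ⇐ binder; 0 users) is withdrawn, its role taken by A-p08's
`casselmanST_of_casselmanFlat`.  §1's scheme-keyed producers stay as landed (true theorems, no binder named).

## References
* [Shimura1998] G. Shimura, *Abelian Varieties with Complex Multiplication and Modular Functions*, Princeton Univ. Press (1998):
  §21.4 Thm. 21.4 and its proof (p. 192: «Hence `𝒫₁` determines `χ`»); Prop. 19.10 with (19.10g) (pp. 136–137); Thm. 19.11 (proof) and
  Lemma 19.5 (p. 133, pp. 137–138); §18.6 Thm. 18.6.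
* [SerreTate1968] J.-P. Serre, J. Tate, *Good reduction of abelian varieties*, Ann. of Math. 88 (1968), §1 Thm. 1 and Lemma 2; §7 Thm. 10–12.
* [BLRNeronModels1990] S. Bosch, W. Lütkebohmert, M. Raynaud, *Néron Models* (1990), §1.2 Prop. 8 and §4.4 Thm. 1.
-/

set_option autoImplicit false

open IsDedekindDomain
open NumberField hiding ideleGroup
open scoped NumberField

namespace Summit.HodgeConjecture.CorCM.Hyp21

open Literature.AlgebraicGeometry.Motives
open Literature.NumberTheory.GaloisRepresentations
open Literature.NumberTheory.ComplexMultiplication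
open CategoryTheory
open scoped ComplexConjugate nonZeroDivisors

/-! ## §1. The ♭ binder body from Thm. 18.6 and the inertia hypothesis (bytes final before and after edition (a)) -/

/-- **Shimura 1998 Thm. 21.4 (Casselman), FLAT reading — Thm. 21.4 + Prop. 19.10 without Thm. 19.11's iff — PROVED from the named
fact `shimura1998_thm18_6` (row II-1) and the inertia hypothesis `h₁₂` («good reduction ⇒ some inertia group above `v` acts trivially on
`T_ℓ A₀`», Lemma 19.5), with NO converse of Néron–Ogg–Šafarevič.**  Under the hypotheses of the binder `shimura1998_thm21_4_casselman`
(`k ⊇ K*`, (19.10a), (19.10b)) there is a structure `(A₀, ι₀)` of type `(K, Φ)` over `k` and the family `(χ_τ)` of Prop. 19.10 with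
`χ_{τ₀} = χ` and, at every good place, the Frobenius element `π ∈ 𝓞_K` with `χ_τ(ϖ_v) = τ(π)` and «Frobenius acts on `T_ℓ A₀` as `ι₀(π)`»
— the conclusion of `shimura1998_thm21_4_casselman.exists_structure` character for character.  Shimura p. 192, last paragraph, made
explicit exactly as in A-p01's `thm21_4_casselman_of_facts`: `(A₀, ι₀)` from the Casselman core (`casselmanCore_of_thm18_6`), `(χ_τ)` from
the ♭ Shimura–Taniyama family (`shimuraTaniyama_heckeCharactersFlat_of_thm18_6_of_inertia`); at the cofinitely many places good for `A₀`
and unramified for `χ` both `χ_{τ₀}(ϖ_v) = τ₀ π` and `χ(ϖ_v) = τ₀ π'` come with «Frobenius = `ι₀(π)`», «Frobenius = `ι₀(π')`» on `T_ℓ A₀`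
(`ℓ ∈ {2, 3}` prime to `v`), so `ι₀ π = ι₀ π'`, `π = π'`, hence `χ_{τ₀} = χ`; clause (4) of the family is never used.
[cite: Shimura1998, §21.4 Thm. 21.4 (proof, p. 192); Prop. 19.10, (19.10g); Thm. 19.11 (proof) with Lemma 19.5; §18.6 Thm. 18.6]
[cite: SerreTate1968, §7 Thm. 10–12; §1 Thm. 1] -/
theorem casselmanFlat_of_thm18_6_of_inertia (h186 : shimura1998_thm18_6)
    (h₁₂ : ∀ (k : Type) [Field k] [NumberField k] (A₀ : AbelianVariety k) (v : HeightOneSpectrum (𝓞 k)),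
      HasGoodReductionAt A₀.X A₀.dim v → ∀ (ℓ : ℕ) [Fact ℓ.Prime], (ℓ : 𝓞 k) ∉ v.asIdeal →
        ∃ 𝔓 ∈ v.primesAbove, ∀ σ ∈ 𝔓.inertia (Field.absoluteGaloisGroup k), A₀.tateRep ℓ σ = 1) :
    ∀ (k : Type) [Field k] [NumberField k] [Algebra k ℂ] (K : Type) [Field K] [NumberField K]
      [IsCMField K] (Φ : CMType K) (τ₀ : K →+* ℂ) (χ : HeckeCharacter k),
    ((traceField Φ : Set ℂ) ⊆ Set.range (algebraMap k ℂ)) →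
    χ.HasInfinityType (cmInfinityType Φ.1 τ₀ (algebraMap k ℂ)).1
      (cmInfinityType Φ.1 τ₀ (algebraMap k ℂ)).2 →
    (∀ x : ideleGroup k, (x : AdeleRing (𝓞 k) k).1 = 1 →
      (∃ b : K, ((χ x : ℂˣ) : ℂ) = τ₀ b) ∧
        ((χ x : ℂˣ) : ℂ) * conj ((χ x : ℂˣ) : ℂ) = (((ideleNorm x)⁻¹ : ℝ) : ℂ)) →
    (∀ (v : HeightOneSpectrum (𝓞 k)) (u : (v.adicCompletionIntegers k)ˣ),
      ∃ b : (𝓞 K)ˣ, ((χ.localComponent v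
        (Units.map ((v.adicCompletionIntegers k).subtype : _ →* _) u) : ℂˣ) : ℂ) =
        τ₀ ((b : 𝓞 K) : K)) →
    (∀ v : HeightOneSpectrum (𝓞 k), ∃ π : 𝓞 K, χ.valueAtUniformizer v = τ₀ (π : K) ∧
      ∀ (L : Type) [Field L] [NumberField L] [Normal ℚ L] (ιL : L →+* ℂ) (j : K →+* L)
        (σL : k →+* L), ιL.comp σL = algebraMap k ℂ →
        IsReflexTypeNorm (valuedIn ιL Φ.1) j σL v.asIdeal (Ideal.span {π})) →
    ∃ (A₀ : AbelianVariety k) (ι₀ : 𝓞 K →+* End A₀), IsCMTypeRealisationOver Φ A₀ ι₀ ∧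
      ∃ χfam : (K →+* ℂ) → HeckeCharacter k, χfam τ₀ = χ ∧
        ∀ v : HeightOneSpectrum (𝓞 k), HasGoodReductionAt A₀.X A₀.dim v →
          ∃ π : 𝓞 K,
            (∀ τ : K →+* ℂ, (χfam τ).valueAtUniformizer v = τ (π : K)) ∧
            (∀ (ℓ : ℕ) [Fact ℓ.Prime], (ℓ : 𝓞 k) ∉ v.asIdeal →
              ∀ 𝔓 ∈ v.primesAbove, ∀ σ : Field.absoluteGaloisGroup k, IsArithFrobAt (𝓞 k) σ 𝔓 →
                A₀.tateRep ℓ σ = AbelianVariety.tateModuleMap ℓ (ι₀ π : A₀ ⟶ A₀)) := by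
  have hcore := casselmanCore_of_thm18_6 h186
  have hST := shimuraTaniyama_heckeCharactersFlat_of_thm18_6_of_inertia h186 h₁₂
  intro k _ _ _ K _ _ _ Φ τ₀ χ hK ha hb hu hπ
  obtain ⟨A₀, ι₀, hreal, hfrob⟩ := hcore k K Φ τ₀ χ hK ha hb hu hπ
  obtain ⟨χfam, -, -, -, -, h5⟩ := hST k K Φ A₀ ι₀ hreal
  have hιinj : Function.Injective ι₀ := injective_of_isCMTypeRealisationOver hreal
  -- cofinitely many good places
  have hgood : ∀ᶠ v in Filter.cofinite, HasGoodReductionAt A₀.X A₀.dim v := by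
    obtain ⟨S, hS, hout⟩ := exists_finite_hasGoodReductionOutside_holds (X := A₀.X) (n := A₀.dim)
      A₀.isSmoothProjective_holds
    exact Filter.eventually_cofinite.2 (hS.subset fun v hv => by
      by_contra hvS
      exact hv (hout v hvS))
  -- cofinitely many unramified places
  have hunr : ∀ᶠ v in Filter.cofinite, χ.IsUnramifiedAt v :=
    (χ.finite_ramifiedPlaces_iff).1 (HeckeCharacter.finite_ramifiedPlaces_holds χ)
  -- the two Frobenius descriptions agree there
  have hev : ∀ᶠ v in Filter.cofinite, (χfam τ₀).valueAtUniformizer v = χ.valueAtUniformizer v := by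
    refine (hgood.and hunr).mono fun v hv => ?_
    obtain ⟨hv1, hv2⟩ := hv
    obtain ⟨π, hπval, hπfrob, -⟩ := h5 v hv1
    obtain ⟨π', hπ'val, hπ'frob⟩ := hfrob v hv2
    obtain ⟨ℓ, hℓprime, hℓv⟩ := exists_prime_natCast_notMem v
    haveI : Fact ℓ.Prime := ⟨hℓprime⟩
    obtain ⟨𝔓, h𝔓⟩ := v.primesAbove_nonempty
    obtain ⟨σ, hσ⟩ :=
      IsDedekindDomain.HeightOneSpectrum.exists_isArithFrobAt_of_mem_primesAbove_holds (K := k) (v := v) h𝔓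
    have e1 := hπfrob ℓ hℓv 𝔓 h𝔓 σ hσ
    have e2 := hπ'frob ℓ hℓv 𝔓 h𝔓 σ hσ
    have hℓk : (ℓ : k) ≠ 0 := Nat.cast_ne_zero.2 hℓprime.ne_zero
    have hιeq : (ι₀ π : A₀ ⟶ A₀) = ι₀ π' :=
      AbelianVariety.hom_ext_of_tateModuleMap_eq ℓ hℓk (e1.symm.trans e2)
    have hππ' : π = π' := hιinj hιeq
    rw [hπval τ₀, hπ'val, hππ']
  have heq : χfam τ₀ = χ := HeckeCharacter.ext_of_eventually_valueAtUniformizer_eq hev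
  refine ⟨A₀, ι₀, hreal, χfam, heq, fun v hv => ?_⟩
  obtain ⟨π, hπa, hπb, -⟩ := h5 v hv
  exact ⟨π, hπa, hπb⟩

/-- **The ♭ binder body ⇐ {row II-1 `shimura1998_thm18_6`, r₀ «a smooth proper model of an abelian variety is an abelian scheme»}** —
`casselmanFlat_of_thm18_6_of_inertia` with the inertia hypothesis `h₁₂` DISCHARGED modulo the bridge r₀ (the body of the cell's named fact
`DiophantineGeometry.exists_isAbelianSchemeModel_of_hasGoodReductionAt` spelled as the binder `hr₀`, exactly as in `H21_of_thm18_6_of_r₀`)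
through `DiophantineGeometry.forall_inertia_tateRep_eq_one_of_hasGoodReductionAt` (Serre–Tate §1 Thm. 1, easy direction: B-p07's Lemma 2
`…injOn_geomTorsion_pow` + B-p09's inertia corollary).  HC_CM is proved only modulo the 7 printed citations until rung 0 closes.
[cite: Shimura1998, §21.4 Thm. 21.4 (proof, p. 192); Prop. 19.10; §18.6 Thm. 18.6] [cite: SerreTate1968, §1 Thm. 1 and Lemma 2; §7 Thm. 10–12]
[cite: BLRNeronModels1990, §1.2 Prop. 8 and §4.4 Thm. 1] -/
theorem casselmanFlat_of_thm18_6_of_r₀ (h186 : shimura1998_thm18_6)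
    (hr₀ : ∀ {K : Type} [Field K] [NumberField K] (A : AbelianVariety K) (v : HeightOneSpectrum (𝓞 K)),
      HasGoodReductionAt A.X A.dim v →
        ∃ (𝒜 : SchemeOver (HeightOneSpectrum.valuationSubringAtPrime K v)) (_ : GrpObj 𝒜),
          Literature.NumberTheory.DiophantineGeometry.IsAbelianSchemeModel A v 𝒜) :
    ∀ (k : Type) [Field k] [NumberField k] [Algebra k ℂ] (K : Type) [Field K] [NumberField K]
      [IsCMField K] (Φ : CMType K) (τ₀ : K →+* ℂ) (χ : HeckeCharacter k),
    ((traceField Φ : Set ℂ) ⊆ Set.range (algebraMap k ℂ)) →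
    χ.HasInfinityType (cmInfinityType Φ.1 τ₀ (algebraMap k ℂ)).1
      (cmInfinityType Φ.1 τ₀ (algebraMap k ℂ)).2 →
    (∀ x : ideleGroup k, (x : AdeleRing (𝓞 k) k).1 = 1 →
      (∃ b : K, ((χ x : ℂˣ) : ℂ) = τ₀ b) ∧
        ((χ x : ℂˣ) : ℂ) * conj ((χ x : ℂˣ) : ℂ) = (((ideleNorm x)⁻¹ : ℝ) : ℂ)) →
    (∀ (v : HeightOneSpectrum (𝓞 k)) (u : (v.adicCompletionIntegers k)ˣ),
      ∃ b : (𝓞 K)ˣ, ((χ.localComponent v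
        (Units.map ((v.adicCompletionIntegers k).subtype : _ →* _) u) : ℂˣ) : ℂ) =
        τ₀ ((b : 𝓞 K) : K)) →
    (∀ v : HeightOneSpectrum (𝓞 k), ∃ π : 𝓞 K, χ.valueAtUniformizer v = τ₀ (π : K) ∧
      ∀ (L : Type) [Field L] [NumberField L] [Normal ℚ L] (ιL : L →+* ℂ) (j : K →+* L)
        (σL : k →+* L), ιL.comp σL = algebraMap k ℂ →
        IsReflexTypeNorm (valuedIn ιL Φ.1) j σL v.asIdeal (Ideal.span {π})) →
    ∃ (A₀ : AbelianVariety k) (ι₀ : 𝓞 K →+* End A₀), IsCMTypeRealisationOver Φ A₀ ι₀ ∧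
      ∃ χfam : (K →+* ℂ) → HeckeCharacter k, χfam τ₀ = χ ∧
        ∀ v : HeightOneSpectrum (𝓞 k), HasGoodReductionAt A₀.X A₀.dim v →
          ∃ π : 𝓞 K,
            (∀ τ : K →+* ℂ, (χfam τ).valueAtUniformizer v = τ (π : K)) ∧
            (∀ (ℓ : ℕ) [Fact ℓ.Prime], (ℓ : 𝓞 k) ∉ v.asIdeal →
              ∀ 𝔓 ∈ v.primesAbove, ∀ σ : Field.absoluteGaloisGroup k, IsArithFrobAt (𝓞 k) σ 𝔓 →
                A₀.tateRep ℓ σ = AbelianVariety.tateModuleMap ℓ (ι₀ π : A₀ ⟶ A₀)) :=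
  casselmanFlat_of_thm18_6_of_inertia h186
    (fun _ _ _ A₀ v hgood ℓ _ hℓ =>
      Literature.NumberTheory.DiophantineGeometry.forall_inertia_tateRep_eq_one_of_hasGoodReductionAt hr₀ A₀ v hgood ℓ hℓ)

/-- **The ♭ binder body ⇐ {S7a `levelStructure`, S5b `exists_balancedDivisor_finiteExtension`, r₀}** — the level-structure reading of the
floor (`thm18_6_of_levelStructure h7a h5b`, then `casselmanFlat_of_thm18_6_of_r₀`).  HC_CM is proved only modulo the 7 printed citations until
rung 0 closes. [cite: Shimura1998, §21.4 Thm. 21.4; §18.6 Thm. 18.6; Prop. 19.10] [cite: SerreTate1968, §1 Thm. 1; §7 Thm. 10–12]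
[cite: BLRNeronModels1990, §1.2 Prop. 8 and §4.4 Thm. 1] -/
theorem casselmanFlat_of_levelStructure_of_r₀ (h7a : levelStructure) (h5b : exists_balancedDivisor_finiteExtension)
    (hr₀ : ∀ {K : Type} [Field K] [NumberField K] (A : AbelianVariety K) (v : HeightOneSpectrum (𝓞 K)),
      HasGoodReductionAt A.X A.dim v →
        ∃ (𝒜 : SchemeOver (HeightOneSpectrum.valuationSubringAtPrime K v)) (_ : GrpObj 𝒜),
          Literature.NumberTheory.DiophantineGeometry.IsAbelianSchemeModel A v 𝒜) :
    ∀ (k : Type) [Field k] [NumberField k] [Algebra k ℂ] (K : Type) [Field K] [NumberField K]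
      [IsCMField K] (Φ : CMType K) (τ₀ : K →+* ℂ) (χ : HeckeCharacter k),
    ((traceField Φ : Set ℂ) ⊆ Set.range (algebraMap k ℂ)) →
    χ.HasInfinityType (cmInfinityType Φ.1 τ₀ (algebraMap k ℂ)).1
      (cmInfinityType Φ.1 τ₀ (algebraMap k ℂ)).2 →
    (∀ x : ideleGroup k, (x : AdeleRing (𝓞 k) k).1 = 1 →
      (∃ b : K, ((χ x : ℂˣ) : ℂ) = τ₀ b) ∧
        ((χ x : ℂˣ) : ℂ) * conj ((χ x : ℂˣ) : ℂ) = (((ideleNorm x)⁻¹ : ℝ) : ℂ)) →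
    (∀ (v : HeightOneSpectrum (𝓞 k)) (u : (v.adicCompletionIntegers k)ˣ),
      ∃ b : (𝓞 K)ˣ, ((χ.localComponent v
        (Units.map ((v.adicCompletionIntegers k).subtype : _ →* _) u) : ℂˣ) : ℂ) =
        τ₀ ((b : 𝓞 K) : K)) →
    (∀ v : HeightOneSpectrum (𝓞 k), ∃ π : 𝓞 K, χ.valueAtUniformizer v = τ₀ (π : K) ∧
      ∀ (L : Type) [Field L] [NumberField L] [Normal ℚ L] (ιL : L →+* ℂ) (j : K →+* L)
        (σL : k →+* L), ιL.comp σL = algebraMap k ℂ →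
        IsReflexTypeNorm (valuedIn ιL Φ.1) j σL v.asIdeal (Ideal.span {π})) →
    ∃ (A₀ : AbelianVariety k) (ι₀ : 𝓞 K →+* End A₀), IsCMTypeRealisationOver Φ A₀ ι₀ ∧
      ∃ χfam : (K →+* ℂ) → HeckeCharacter k, χfam τ₀ = χ ∧
        ∀ v : HeightOneSpectrum (𝓞 k), HasGoodReductionAt A₀.X A₀.dim v →
          ∃ π : 𝓞 K,
            (∀ τ : K →+* ℂ, (χfam τ).valueAtUniformizer v = τ (π : K)) ∧
            (∀ (ℓ : ℕ) [Fact ℓ.Prime], (ℓ : 𝓞 k) ∉ v.asIdeal →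
              ∀ 𝔓 ∈ v.primesAbove, ∀ σ : Field.absoluteGaloisGroup k, IsArithFrobAt (𝓞 k) σ 𝔓 →
                A₀.tateRep ℓ σ = AbelianVariety.tateModuleMap ℓ (ι₀ π : A₀ ⟶ A₀)) :=
  casselmanFlat_of_thm18_6_of_r₀ (thm18_6_of_levelStructure h7a h5b) hr₀

/-! ## §2. The r₀-FREE heads (edition E-ST, Phase B: the binder's Frobenius clause is keyed on SERRE–TATE good reduction
«`A₀` has an abelian-scheme model over `𝓞_{k,v}`» — B-typ02's re-keyed `def`; the producers are A-p08's
`casselmanST_of_thm18_6` / `casselmanST_of_levelStructure` of `HCCMUnconditionalH21OfAbelianSchemeModel`) -/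

/-- **[Shimura1998, Thm. 21.4] (Casselman) — the `h21` binder `shimura1998_thm21_4_casselman` in its Serre–Tate-keyed reading (editions
E-19.11♭1 + E-ST) — PROVED from `shimura1998_thm18_6` (row II-1) ALONE: no inertia hypothesis, no converse of Néron–Ogg–Šafarevič, no bridge
r₀.**  A-p08's `casselmanST_of_thm18_6`, whose conclusion is the binder's body character for character since edition E-ST.
HC_CM is proved only modulo the 7 printed citations until rung 0 closes.
[cite: Shimura1998, §21.4 Thm. 21.4 (proof, p. 192); Prop. 19.10, (19.10g); §18.6 Thm. 18.6; Lemma 19.5]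
[cite: SerreTate1968, §1 (definition of good reduction, p. 492), Thm. 1 and Lemma 2; §7 Thm. 10–12] -/
theorem thm21_4_casselman_of_thm18_6_ST (h186 : shimura1998_thm18_6) : shimura1998_thm21_4_casselman :=
  fun k _ _ _ K _ _ _ Φ τ₀ χ hK ha hb hu hπ =>
    casselmanST_of_thm18_6 h186 k K Φ τ₀ χ hK ha hb hu hπ

/-- **`HCCMUnconditional.H21` ⇐ row II-1 `shimura1998_thm18_6` ALONE** (`H21 = Hyp21 = shimura1998_thm21_4_casselman` by `rfl`; the E-ST
successor of `H21_of_thm18_6_of_inertiaFlat` / `H21_of_thm18_6_of_r₀Flat`, two binders fewer).  HC_CM is proved only modulo the 7 printed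
citations until rung 0 closes. [cite: Shimura1998, §21.4 Thm. 21.4; §18.6 Thm. 18.6] [cite: SerreTate1968, §1 Thm. 1; §7 Thm. 10–12] -/
theorem H21_of_thm18_6_ST (h186 : shimura1998_thm18_6) :
    Summit.HodgeConjecture.HodgeConjecture.Theses.HCCMUnconditional.H21 :=
  thm21_4_casselman_of_thm18_6_ST h186

/-- **`HCCMUnconditional.H21` ⇐ {S7a `levelStructure`, S5b `exists_balancedDivisor_finiteExtension`} and NOTHING ELSE — the `h21` leg of the
cell's floor after edition E-ST** (the successor of `H21_of_levelStructure_of_r₀Flat` with the bridge r₀ gone; via `thm18_6_of_levelStructure`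
then `H21_of_thm18_6_ST`).  HC_CM is proved only modulo the 7 printed citations until rung 0 closes.
[cite: Shimura1998, §21.4 Thm. 21.4; §18.6 Thm. 18.6] [cite: SerreTate1968, §1 Thm. 1; §7 Thm. 10–12] -/
theorem H21_of_levelStructure_ST (h7a : levelStructure) (h5b : exists_balancedDivisor_finiteExtension) :
    Summit.HodgeConjecture.HodgeConjecture.Theses.HCCMUnconditional.H21 :=
  H21_of_thm18_6_ST (thm18_6_of_levelStructure h7a h5b)

/-- **The same on the binder's named `Prop`**: [Shimura1998, Thm. 21.4] in its Serre–Tate-keyed reading ⇐ {S7a, S5b}.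
[cite: Shimura1998, §21.4 Thm. 21.4; §18.6 Thm. 18.6] [cite: SerreTate1968, §1 Thm. 1; §7 Thm. 10–12] -/
theorem thm21_4_casselman_of_levelStructure_ST (h7a : levelStructure) (h5b : exists_balancedDivisor_finiteExtension) :
    shimura1998_thm21_4_casselman :=
  H21_of_levelStructure_ST h7a h5b

/-! ## §3. The E-19.11♭1 heads, NAMES AND TYPES KEPT for their landed consumers (floor `hc_cm_of_floor_v7` cites
`H21_of_levelStructure_of_r₀Flat`; a2 editions), re-proved since edition E-ST through §1's scheme-keyed producers and A-p08's weakening `casselmanST_of_casselmanFlat` (an abelian-scheme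
model is a smooth proper model) — STATEMENTS BYTE-IDENTICAL to the landed ones; the binder itself no longer needs their inertia / r₀
hypotheses (§2) -/

/-- **[Shimura1998, Thm. 21.4] (Casselman) ⇐ {`shimura1998_thm18_6`, the inertia hypothesis}** — E-19.11♭1 head, kept by name and type;
since edition E-ST proved as §1's scheme-keyed producer followed by A-p08's weakening `casselmanST_of_casselmanFlat` (see
`thm21_4_casselman_of_thm18_6_ST` for the hypothesis-free form).  HC_CM is proved only modulo the 7 printed citations until
rung 0 closes. [cite: Shimura1998, §21.4 Thm. 21.4; §18.6 Thm. 18.6; Lemma 19.5] [cite: SerreTate1968, §1 Thm. 1; §7 Thm. 10–12] -/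
theorem thm21_4_casselman_of_thm18_6_of_inertiaFlat (h186 : shimura1998_thm18_6)
    (h₁₂ : ∀ (k : Type) [Field k] [NumberField k] (A₀ : AbelianVariety k) (v : HeightOneSpectrum (𝓞 k)),
      HasGoodReductionAt A₀.X A₀.dim v → ∀ (ℓ : ℕ) [Fact ℓ.Prime], (ℓ : 𝓞 k) ∉ v.asIdeal →
        ∃ 𝔓 ∈ v.primesAbove, ∀ σ ∈ 𝔓.inertia (Field.absoluteGaloisGroup k), A₀.tateRep ℓ σ = 1) :
    shimura1998_thm21_4_casselman :=
  fun k _ _ _ K _ _ _ Φ τ₀ χ hK ha hb hu hπ =>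
    casselmanST_of_casselmanFlat (casselmanFlat_of_thm18_6_of_inertia h186 h₁₂) k K Φ τ₀ χ hK ha hb hu hπ

/-- **`HCCMUnconditional.H21` ⇐ {row II-1 `shimura1998_thm18_6`, the inertia hypothesis}** — E-19.11♭1 head, kept by name and type
(see `H21_of_thm18_6_ST` for the form without the inertia hypothesis since edition E-ST).  HC_CM is proved only modulo the 7 printed citations until rung 0 closes.
[cite: Shimura1998, §21.4 Thm. 21.4; §18.6 Thm. 18.6; Lemma 19.5] [cite: SerreTate1968, §1 Thm. 1; §7 Thm. 10–12] -/
theorem H21_of_thm18_6_of_inertiaFlat (h186 : shimura1998_thm18_6)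
    (h₁₂ : ∀ (k : Type) [Field k] [NumberField k] (A₀ : AbelianVariety k) (v : HeightOneSpectrum (𝓞 k)),
      HasGoodReductionAt A₀.X A₀.dim v → ∀ (ℓ : ℕ) [Fact ℓ.Prime], (ℓ : 𝓞 k) ∉ v.asIdeal →
        ∃ 𝔓 ∈ v.primesAbove, ∀ σ ∈ 𝔓.inertia (Field.absoluteGaloisGroup k), A₀.tateRep ℓ σ = 1) :
    Summit.HodgeConjecture.HodgeConjecture.Theses.HCCMUnconditional.H21 :=
  thm21_4_casselman_of_thm18_6_of_inertiaFlat h186 h₁₂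

/-- **`HCCMUnconditional.H21` ⇐ {row II-1 `shimura1998_thm18_6`, r₀}** — E-19.11♭1 head, kept by name and type
(see `H21_of_thm18_6_ST` for the r₀-free form since edition E-ST).  HC_CM is proved only modulo the 7 printed citations until rung 0 closes.
[cite: Shimura1998, §21.4 Thm. 21.4; §18.6 Thm. 18.6] [cite: SerreTate1968, §1 Thm. 1 and Lemma 2; §7 Thm. 10–12]
[cite: BLRNeronModels1990, §1.2 Prop. 8 and §4.4 Thm. 1] -/
theorem H21_of_thm18_6_of_r₀Flat (h186 : shimura1998_thm18_6)
    (hr₀ : ∀ {K : Type} [Field K] [NumberField K] (A : AbelianVariety K) (v : HeightOneSpectrum (𝓞 K)),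
      HasGoodReductionAt A.X A.dim v →
        ∃ (𝒜 : SchemeOver (HeightOneSpectrum.valuationSubringAtPrime K v)) (_ : GrpObj 𝒜),
          Literature.NumberTheory.DiophantineGeometry.IsAbelianSchemeModel A v 𝒜) :
    Summit.HodgeConjecture.HodgeConjecture.Theses.HCCMUnconditional.H21 :=
  H21_of_thm18_6_of_inertiaFlat h186
    (fun _ _ _ A₀ v hgood ℓ _ hℓ =>
      Literature.NumberTheory.DiophantineGeometry.forall_inertia_tateRep_eq_one_of_hasGoodReductionAt hr₀ A₀ v hgood ℓ hℓ)

/-- **`HCCMUnconditional.H21` ⇐ {S7a `levelStructure`, S5b, r₀}** — the `h21` leg of the floor editions v7/v8 (`hc_cm_of_floor_v7`), kept by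
name and type (see `H21_of_levelStructure_ST` for the r₀-free form since edition E-ST).  HC_CM is proved only modulo the 7 printed citations
until rung 0 closes. [cite: Shimura1998, §21.4 Thm. 21.4; §18.6 Thm. 18.6] [cite: SerreTate1968, §1 Thm. 1; §7 Thm. 10–12]
[cite: BLRNeronModels1990, §1.2 Prop. 8 and §4.4 Thm. 1] -/
theorem H21_of_levelStructure_of_r₀Flat (h7a : levelStructure) (h5b : exists_balancedDivisor_finiteExtension)
    (hr₀ : ∀ {K : Type} [Field K] [NumberField K] (A : AbelianVariety K) (v : HeightOneSpectrum (𝓞 K)),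
      HasGoodReductionAt A.X A.dim v →
        ∃ (𝒜 : SchemeOver (HeightOneSpectrum.valuationSubringAtPrime K v)) (_ : GrpObj 𝒜),
          Literature.NumberTheory.DiophantineGeometry.IsAbelianSchemeModel A v 𝒜) :
    Summit.HodgeConjecture.HodgeConjecture.Theses.HCCMUnconditional.H21 :=
  H21_of_thm18_6_of_r₀Flat (thm18_6_of_levelStructure h7a h5b) hr₀

/-- **The same on the binder's named `Prop`** — E-19.11♭1 head kept by name and type (r₀-free form: `thm21_4_casselman_of_levelStructure_ST`).
[cite: Shimura1998, §21.4 Thm. 21.4; §18.6 Thm. 18.6] [cite: SerreTate1968, §1 Thm. 1; §7 Thm. 10–12] -/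
theorem thm21_4_casselman_of_levelStructure_of_r₀Flat (h7a : levelStructure) (h5b : exists_balancedDivisor_finiteExtension)
    (hr₀ : ∀ {K : Type} [Field K] [NumberField K] (A : AbelianVariety K) (v : HeightOneSpectrum (𝓞 K)),
      HasGoodReductionAt A.X A.dim v →
        ∃ (𝒜 : SchemeOver (HeightOneSpectrum.valuationSubringAtPrime K v)) (_ : GrpObj 𝒜),
          Literature.NumberTheory.DiophantineGeometry.IsAbelianSchemeModel A v 𝒜) :
    shimura1998_thm21_4_casselman :=
  H21_of_levelStructure_of_r₀Flat h7a h5b hr₀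

end Summit.HodgeConjecture.CorCM.Hyp21
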